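import Literature.AlgebraicGeometry.Motives.SemilinearAutBaseChange
import Literature.AlgebraicGeometry.Motives.ComplexAutGaloisDescentIso
import HarnessLib

/-!
# The Galois descent datum on a model over a compositum, manufactured from compatible complex twists
# ([Deligne 1971] Prop. 5.10 via Cor. 5.5 + Lemme 5.10.1 — the generic half «D1/D2»)

Topic `AlgebraicGeometry/Motives`; namespace `Literature.AlgebraicGeometry.Motives.GaloisDescentTwist`.  Definitions by explicit
formula + theorems; no named fact, no instance, no `sorry` (net Literature debt 0).  Cell `hodgecm-mathlib`, row I-6
(`descentToIntersection_printed`), crew of 2026-08-28 (lead A-p08; pieces: Λ = A-p07 complex twists, P0 = A-p02, P2 = A-p03,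
P3-gen = B-typ01, P4 = A-p16, D0 ✔ `SemilinearAutBaseChange` = A-p08).  THIS FILE (D1/D2) is GENERIC — no Shimura imports.

## Setting (abstract form of [Deligne1971TravauxShimura] 5.10)

* a diagram `Z : J ⥤ SchemeOver ℂ` of complex schemes (in the cell: the complex Shimura tower `Sc.Mc`);
* a TWIST PREDICATE `Tw j σ lam` on automorphisms `lam` of the schemes `(Z j).left` indexed by ring automorphisms `σ` of `ℂ`
  (in the cell: A-p07's «Galois twist automorphisms»: `lam` covers `Spec σ⁻¹` and moves the special points by Shimura reciprocity),
  with the four properties the complex side supplies — UNIQUENESS (`huniq`), IDENTITY (`hone`), PRODUCTS (`hmul`), NATURALITY in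
  `j` (`hnat`) — and one more tying it to models:
* a finite family of MODELS: fields `F i` inside `ℂ`, each containing a common field `k` and contained in a common field `L ⊂ ℂ`
  (`k → F i → L → ℂ`, all `IsScalarTower`), functors `M i : J ⥤ SchemeOver (F i)` with forms `e i : M i ⊗_{F i} ℂ ≅ Z`, such that
  (`hgal`) for every `σ ∈ Aut(ℂ/F i)` the `e i`-conjugate of the Galois automorphism `1 × Spec σ⁻¹` of `M i j ⊗ ℂ` IS a twist for `σ`
  (in the cell: [Milne2005ShimuraVarieties] (62) for the model over `E_i`, A-p07's §3);
* generation: the subgroups `Gal(L/F i)` generate `Gal(L/k)` (`hgen`, in the cell: `k = ⋂ F i`, P2), and every `γ ∈ Gal(L/k)` extends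
  to an automorphism of `ℂ` (`hext`, P0).

## Results

For the model `N := M i₀ ⊗_{F i₀} L` over `L`:
* `Good j γ φ` — the RIGIDITY predicate on `γ`-semilinear automorphisms `φ` of `N j`: for EVERY extension `σ̃` of `γ` to `ℂ`, the
  twisted base change `φ ⊠ σ̃` (✔ `twistBC`), read on `Z j` through the tower-and-form identification `Θ : N j ⊗_L ℂ ≅ Z j`, is a twist;
* `good_unique`, `good_one`, `good_mul`, `good_inv` — rigidity: `Good` is unique per `γ` and closed under the group operations
  (uniqueness: ✔ `eq_of_twistBC_eq`; products: ✔ `twistBC_comp` + `hmul`; identity: ✔ `twistBC_gal_tower` + `hgal` at `i₀`);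
* `good_of_mem` — EXISTENCE on the generating subgroups: for `γ ∈ Gal(L/F i)` the conjugate of the Galois automorphism of
  `M i j ⊗ L` by the `L`-isomorphism `ψ i j : N j ≅ M i j ⊗ L` is `Good`; the `ψ i j` themselves are DESCENDED from the complex
  identifications `Θ_{i₀} ≫ Θ_i⁻¹` by [Milne2005ShimuraVarieties] Prop. 13.1 (✔ `GaloisDescent.existsUnique_map_eq_complex`), their
  `Aut(ℂ/L)`-equivariance being `huniq` + `hgal`;
* `good_natural` — two `Good` automorphisms at levels `j → j′` commute with the transition map (from `hnat` + ✔ `comp_eq_comp_of_twistBC`).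
These are exactly the hypotheses of B-typ01's `exists_actionOver_galois_of_generators_of_semilinear` (P3-gen) and, with its
output, the fields of A-p16's `GaloisDescentFunctor.Datum` (P4); the assembly is the cell's file D4.

HC_CM is proved only modulo the 7 printed citations until rung 0 closes; this file proves no cell binder by itself.

## References
* [Deligne1971TravauxShimura] P. Deligne, *Travaux de Shimura*, Sém. Bourbaki 389 (1971), Cor. 5.5, Prop. 5.10, Lemme 5.10.1 (pp. 156–158).
* [Milne2005ShimuraVarieties] J. S. Milne, *Introduction to Shimura varieties* (2005/2017), Prop. 13.1 ∕ Cor. 13.2 p. 117, Thm. 13.6 p. 118.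
* [GortzWedhorn2020] U. Görtz, T. Wedhorn, *Algebraic Geometry I* (2nd ed. 2020), §(14.20)–(14.21), Thm. 14.72 (1), Thm. 14.83.
-/

noncomputable section

open CategoryTheory CategoryTheory.Limits AlgebraicGeometry Cardinal

namespace Literature.AlgebraicGeometry.Motives

namespace GaloisDescentTwist

open AbelianVariety (bcSpec bcFunctor specAut specAut_mul specAut_one specAut_comp_bcSpec
  specAut_comp_specAut_symm specAut_symm_comp_specAut bcFunctorTowerIso bcFunctor_map_injective)
open GaloisDescent

set_option backward.isDefEq.respectTransparency false

/-! ### §0. (Prop. 13.1 for isomorphisms is the tree's `GaloisDescent.exists_iso_map_eq_of_forall_gal_comp_of_isReduced`, A-p16.) -/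

/-! ### §1. The setting: complex diagram, twist predicate, models over subfields, the model `N` over the compositum -/

section Setting

variable {J : Type} [Category J] (Z : J ⥤ SchemeOver ℂ)
  (Tw : ∀ j : J, (ℂ ≃+* ℂ) → ((Z.obj j).left ⟶ (Z.obj j).left) → Prop)
  {k : Type} [Field k] (L : Type) [Field L] [Algebra k L] [Algebra L ℂ]
  {ι : Type} {F : ι → Type} [∀ i, Field (F i)] [∀ i, Algebra (F i) L] [∀ i, Algebra (F i) ℂ]
  [∀ i, IsScalarTower (F i) L ℂ]
  (M : ∀ i, J ⥤ SchemeOver (F i)) (e : ∀ i, (M i ⋙ bcFunctor (F i) ℂ) ≅ Z)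

/-- The model over `F i`, base-changed to the common overfield `L`: `N i := M i ⊗_{F i} L : J ⥤ SchemeOver L`.
[cite: Deligne1971TravauxShimura, Prop. 5.10 proof (p. 157)] -/
abbrev N (i : ι) : J ⥤ SchemeOver L := M i ⋙ bcFunctor (F i) L

/-- **The identification `Θ_i : (M i ⊗ L) ⊗_L ℂ ≅ Z` of functors** — the tower isomorphism `(M i j ⊗_{F i} L) ⊗_L ℂ ≅ M i j ⊗_{F i} ℂ`
followed by the form `e i`. [cite: GortzWedhorn2020, Prop. 4.16 and §(4.8)] [cite: Deligne1971TravauxShimura, Prop. 5.10 proof (p. 157)] -/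
def ThetaIso (i : ι) : (N L M i ⋙ bcFunctor L ℂ) ≅ Z :=
  Functor.associator (M i) (bcFunctor (F i) L) (bcFunctor L ℂ) ≪≫
    Functor.isoWhiskerLeft (M i) (bcFunctorTowerIso (F i) L ℂ) ≪≫ e i

/-- On underlying schemes, at `j`: `Θ_i j : bc ℂ (N i j) ≅ (Z j).left`. [cite: GortzWedhorn2020, Prop. 4.16] -/
def Theta (i : ι) (j : J) : bc ℂ ((N L M i).obj j) ≅ (Z.obj j).left :=
  (Over.forget _).mapIso ((ThetaIso Z L M e i).app j)

/-- The component formula: `(Θ_i j).hom = (tower iso at M i j).left ≫ (e i j).left`. [cite: GortzWedhorn2020, Prop. 4.16] -/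
theorem Theta_hom (i : ι) (j : J) :
    (Theta Z L M e i j).hom = ((bcFunctorTowerIso (F i) L ℂ).hom.app ((M i).obj j)).left ≫ ((e i).hom.app j).left := by
  change (((ThetaIso Z L M e i).hom.app j)).left = _
  simp only [ThetaIso, Iso.trans_hom, NatTrans.comp_app, Functor.associator_hom_app, Functor.isoWhiskerLeft_hom,
    Functor.whiskerLeft_app, Category.id_comp, Over.comp_left]

/-- The inverse component formula. [cite: GortzWedhorn2020, Prop. 4.16] -/
theorem Theta_inv (i : ι) (j : J) :
    (Theta Z L M e i j).inv = ((e i).inv.app j).left ≫ ((bcFunctorTowerIso (F i) L ℂ).inv.app ((M i).obj j)).left := by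
  change (((ThetaIso Z L M e i).inv.app j)).left = _
  simp only [ThetaIso, Iso.trans_inv, NatTrans.comp_app, Functor.associator_inv_app, Functor.isoWhiskerLeft_inv,
    Functor.whiskerLeft_app, Category.comp_id, Over.comp_left, Category.assoc]

/-- Naturality of `Θ_i` in `j` on underlying schemes. [cite: GortzWedhorn2020, Prop. 4.16] -/
theorem Theta_natural (i : ι) {j j' : J} (f : j ⟶ j') :
    ((bcFunctor L ℂ).map ((N L M i).map f)).left ≫ (Theta Z L M e i j').hom = (Theta Z L M e i j).hom ≫ (Z.map f).left := by
  have h := (ThetaIso Z L M e i).hom.naturality f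
  have h' := congrArg CommaMorphism.left h
  simp only [Functor.comp_map, Over.comp_left] at h'
  exact h'

/-- **Conjugation by `Θ`**: an endomorphism `X` of `bc ℂ (N i j)` read on `(Z j).left`. [cite: Deligne1971TravauxShimura, Prop. 5.10 proof] -/
def conjTheta (i : ι) (j : J) (X : bc ℂ ((N L M i).obj j) ⟶ bc ℂ ((N L M i).obj j)) : (Z.obj j).left ⟶ (Z.obj j).left :=
  (Theta Z L M e i j).inv ≫ X ≫ (Theta Z L M e i j).hom

/-- Conjugation by `Θ` is injective. [cite: Deligne1971TravauxShimura, Prop. 5.10 proof] -/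
theorem conjTheta_injective (i : ι) (j : J) {X X' : bc ℂ ((N L M i).obj j) ⟶ bc ℂ ((N L M i).obj j)}
    (h : conjTheta Z L M e i j X = conjTheta Z L M e i j X') : X = X' := by
  have h' := congrArg (fun u => (Theta Z L M e i j).hom ≫ u ≫ (Theta Z L M e i j).inv) h
  simpa only [conjTheta, Category.assoc, Iso.hom_inv_id_assoc, Iso.hom_inv_id, Category.comp_id] using h'

/-- Conjugation by `Θ` is multiplicative. [cite: Deligne1971TravauxShimura, Lemme 5.10.1] -/
theorem conjTheta_comp (i : ι) (j : J) (X X' : bc ℂ ((N L M i).obj j) ⟶ bc ℂ ((N L M i).obj j)) :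
    conjTheta Z L M e i j X ≫ conjTheta Z L M e i j X' = conjTheta Z L M e i j (X ≫ X') := by
  simp only [conjTheta, Category.assoc, Iso.hom_inv_id_assoc]

/-- Conjugation by `Θ` of the identity. [cite: Deligne1971TravauxShimura, Lemme 5.10.1] -/
theorem conjTheta_id (i : ι) (j : J) : conjTheta Z L M e i j (𝟙 _) = 𝟙 _ := by
  simp only [conjTheta, Category.id_comp, Iso.inv_hom_id]

/-- Congruence of `twistBC` in its data (the proof arguments are irrelevant). [cite: GortzWedhorn2020, §(14.20)] -/
theorem twistBC_congr (Y : SchemeOver L) {γ γ' : L ≃ₐ[k] L} {σ σ' : ℂ ≃+* ℂ} {ρ ρ' : Y.left ⟶ Y.left}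
    (hσ : ∀ x : L, σ (algebraMap L ℂ x) = algebraMap L ℂ (γ x)) (hρ : ρ ≫ Y.hom = Y.hom ≫ specAut L γ⁻¹)
    (hσ' : ∀ x : L, σ' (algebraMap L ℂ x) = algebraMap L ℂ (γ' x)) (hρ' : ρ' ≫ Y.hom = Y.hom ≫ specAut L γ'⁻¹)
    (h₁ : γ = γ') (h₂ : σ = σ') (h₃ : ρ = ρ') :
    twistBC ℂ Y γ σ hσ ρ hρ = twistBC ℂ Y γ' σ' hσ' ρ' hρ' := by
  subst h₁ h₂ h₃
  rfl

/-! ### §2. The rigidity predicate `Good` and its closure properties -/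

variable (i₀ : ι)

/-- **`Good j γ φ` — rigidity of a `γ`-semilinear automorphism `φ` of `N j = M i₀ j ⊗ L`**: `φ` covers `Spec γ⁻¹`, and for EVERY ring
automorphism `σ̃` of `ℂ` extending `γ` the twisted base change `φ ⊠ σ̃` (✔ `twistBC`), read on `Z j` through `Θ_{i₀}`, is a twist for `σ̃`.
[cite: Deligne1971TravauxShimura, Prop. 5.10 proof and Lemme 5.10.1 (pp. 157–158)] -/
def Good (j : J) (γ : L ≃ₐ[k] L) (φ : ((N L M i₀).obj j).left ≅ ((N L M i₀).obj j).left) : Prop :=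
  ∃ hφ : φ.hom ≫ ((N L M i₀).obj j).hom = ((N L M i₀).obj j).hom ≫ specAut L γ⁻¹,
    ∀ (σ : ℂ ≃+* ℂ) (hσ : ∀ x : L, σ (algebraMap L ℂ x) = algebraMap L ℂ (γ x)),
      Tw j σ (conjTheta Z L M e i₀ j (twistBC ℂ ((N L M i₀).obj j) γ σ hσ φ.hom hφ))

variable (hext : ∀ γ : L ≃ₐ[k] L, ∃ σ : ℂ ≃+* ℂ, ∀ x : L, σ (algebraMap L ℂ x) = algebraMap L ℂ (γ x))
  (huniq : ∀ (j : J) (σ : ℂ ≃+* ℂ) (u v : (Z.obj j).left ⟶ (Z.obj j).left), Tw j σ u → Tw j σ v → u = v)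

/-- `Good` automorphisms are semilinear. [cite: Deligne1971TravauxShimura, Lemme 5.10.1] -/
theorem Good.semilinear {j : J} {γ : L ≃ₐ[k] L} {φ : ((N L M i₀).obj j).left ≅ ((N L M i₀).obj j).left}
    (h : Good Z Tw L M e i₀ j γ φ) : φ.hom ≫ ((N L M i₀).obj j).hom = ((N L M i₀).obj j).hom ≫ specAut L γ⁻¹ :=
  h.1

include hext huniq in
/-- **Uniqueness**: two `Good` automorphisms for the same `γ` coincide — their twisted base changes by a common extension `σ̃` are
both THE twist for `σ̃`, and `⊠` is faithful (✔ `eq_of_twistBC_eq`). [cite: Deligne1971TravauxShimura, Cor. 5.5 and Prop. 5.10 proof]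
[cite: GortzWedhorn2020, Thm. 14.72 (1)] -/
theorem good_unique (j : J) (γ : L ≃ₐ[k] L) (φ ψ : ((N L M i₀).obj j).left ≅ ((N L M i₀).obj j).left)
    (hφ : Good Z Tw L M e i₀ j γ φ) (hψ : Good Z Tw L M e i₀ j γ ψ) : φ = ψ := by
  obtain ⟨σ, hσ⟩ := hext γ
  obtain ⟨hφs, hφt⟩ := hφ
  obtain ⟨hψs, hψt⟩ := hψ
  have h := conjTheta_injective Z L M e i₀ j (huniq j σ _ _ (hφt σ hσ) (hψt σ hσ))
  exact Iso.ext (eq_of_twistBC_eq ℂ ((N L M i₀).obj j) γ σ hσ hφs hψs h)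

/-! ### §3. Extensions of field automorphisms: bookkeeping -/

omit [Algebra k L] in
/-- If `σ` extends `γ` then `σ⁻¹` extends `γ⁻¹`. [cite: GortzWedhorn2020, §(14.20)] -/
theorem symm_extends {K' : Type} [Field K'] [Algebra K' L] (γ : L ≃ₐ[K'] L) (σ : ℂ ≃+* ℂ)
    (hσ : ∀ x : L, σ (algebraMap L ℂ x) = algebraMap L ℂ (γ x)) :
    ∀ x : L, σ.symm (algebraMap L ℂ x) = algebraMap L ℂ (γ⁻¹ x) := fun x => by
  rw [RingEquiv.symm_apply_eq, hσ, AlgEquiv.aut_inv, AlgEquiv.apply_symm_apply]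

/-- An automorphism of `ℂ` fixing `L` pointwise, as an `L`-algebra automorphism. [cite: GortzWedhorn2020, §(14.20)] -/
def algEquivOfFix {K' : Type} [Field K'] [Algebra K' ℂ] (σ : ℂ ≃+* ℂ) (hσ : ∀ x : K', σ (algebraMap K' ℂ x) = algebraMap K' ℂ x) :
    ℂ ≃ₐ[K'] ℂ :=
  AlgEquiv.ofRingEquiv (f := σ) hσ

/-- Its underlying ring automorphism is `σ`. [cite: GortzWedhorn2020, §(14.20)] -/
theorem coe_algEquivOfFix {K' : Type} [Field K'] [Algebra K' ℂ] (σ : ℂ ≃+* ℂ)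
    (hσ : ∀ x : K', σ (algebraMap K' ℂ x) = algebraMap K' ℂ x) : (algEquivOfFix σ hσ : ℂ ≃+* ℂ) = σ :=
  RingEquiv.ext fun _ => rfl

/-- An automorphism of `ℂ` fixing `L` fixes every `F i ⊆ L`. [cite: GortzWedhorn2020, §(14.20)] -/
theorem fix_of_fix_of_isScalarTower (i : ι) (σ : ℂ ≃+* ℂ) (hσ : ∀ x : L, σ (algebraMap L ℂ x) = algebraMap L ℂ x) :
    ∀ x : F i, σ (algebraMap (F i) ℂ x) = algebraMap (F i) ℂ x := fun x => by
  rw [IsScalarTower.algebraMap_apply (F i) L ℂ x, hσ]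

/-- An automorphism of `ℂ` extending `γ ∈ Aut(L / F i)` fixes `F i`. [cite: GortzWedhorn2020, §(14.20)] -/
theorem fix_of_extends (i : ι) (γ : L ≃ₐ[F i] L) (σ : ℂ ≃+* ℂ)
    (hσ : ∀ x : L, σ (algebraMap L ℂ x) = algebraMap L ℂ (γ x)) :
    ∀ x : F i, σ (algebraMap (F i) ℂ x) = algebraMap (F i) ℂ x := fun x => by
  rw [IsScalarTower.algebraMap_apply (F i) L ℂ x, hσ, AlgEquiv.commutes]

/-! ### §4. The twists of the models, read through `Θ`: the tower computation -/

variable (hgal : ∀ (i : ι) (j : J) (σ : ℂ ≃ₐ[F i] ℂ),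
    Tw j (σ : ℂ ≃+* ℂ) (((e i).inv.app j).left ≫ gal ℂ ((M i).obj j) σ ≫ ((e i).hom.app j).left))

/-- **The Galois automorphism `gal γ′` of `M i j ⊗ L`, twisted to `ℂ` by an extension `σ` and read on `Z j` through `Θ_i`, is the
`e i`-conjugate of the Galois automorphism `gal σ` of `M i j ⊗ ℂ`** (✔ `twistBC_gal_tower` + the component formulas of `Θ_i`).
[cite: GortzWedhorn2020, Prop. 4.16, §(4.8) and §(14.20)] [cite: Deligne1971TravauxShimura, Prop. 5.10 proof (p. 157)] -/
theorem conjTheta_twistBC_gal (i : ι) (j : J) (γ' : L ≃ₐ[F i] L) (γ : L ≃ₐ[k] L) (hγ : ∀ x, γ x = γ' x)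
    (σ' : ℂ ≃ₐ[F i] ℂ) (σ : ℂ ≃+* ℂ) (hσσ : σ = (σ' : ℂ ≃+* ℂ))
    (hσ : ∀ x : L, σ (algebraMap L ℂ x) = algebraMap L ℂ (γ x))
    (hρ : gal L ((M i).obj j) γ' ≫ ((N L M i).obj j).hom = ((N L M i).obj j).hom ≫ specAut L γ⁻¹) :
    conjTheta Z L M e i j (twistBC ℂ ((N L M i).obj j) γ σ hσ (gal L ((M i).obj j) γ') hρ) =
      ((e i).inv.app j).left ≫ gal ℂ ((M i).obj j) σ' ≫ ((e i).hom.app j).left := by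
  subst hσσ
  have htower := twistBC_gal_tower ℂ (F i) ((M i).obj j) γ' γ hγ σ' hσ
  have hTT : ((bcFunctorTowerIso (F i) L ℂ).inv.app ((M i).obj j)).left ≫
      ((bcFunctorTowerIso (F i) L ℂ).hom.app ((M i).obj j)).left = 𝟙 _ :=
    congrArg CommaMorphism.left ((bcFunctorTowerIso (F i) L ℂ).inv_hom_id_app ((M i).obj j))
  have htower' : twistBC ℂ ((N L M i).obj j) γ (σ' : ℂ ≃+* ℂ) hσ (gal L ((M i).obj j) γ') hρ ≫
      ((bcFunctorTowerIso (F i) L ℂ).hom.app ((M i).obj j)).left =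
      ((bcFunctorTowerIso (F i) L ℂ).hom.app ((M i).obj j)).left ≫ gal ℂ ((M i).obj j) σ' := htower
  -- bookkeeping in term mode (objects `(M i ⋙ bc).obj j` / `bc ℂ (N i j)` agree only up to unfolding)
  have h1 : twistBC ℂ ((N L M i).obj j) γ (σ' : ℂ ≃+* ℂ) hσ (gal L ((M i).obj j) γ') hρ ≫
      ((bcFunctorTowerIso (F i) L ℂ).hom.app ((M i).obj j)).left ≫ ((e i).hom.app j).left =
      ((bcFunctorTowerIso (F i) L ℂ).hom.app ((M i).obj j)).left ≫ gal ℂ ((M i).obj j) σ' ≫ ((e i).hom.app j).left :=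
    (Category.assoc _ _ _).symm.trans ((eq_whisker htower' _).trans (Category.assoc _ _ _))
  have h2 : ((bcFunctorTowerIso (F i) L ℂ).inv.app ((M i).obj j)).left ≫
      ((bcFunctorTowerIso (F i) L ℂ).hom.app ((M i).obj j)).left ≫ gal ℂ ((M i).obj j) σ' ≫ ((e i).hom.app j).left =
      gal ℂ ((M i).obj j) σ' ≫ ((e i).hom.app j).left :=
    (Category.assoc _ _ _).symm.trans ((eq_whisker hTT _).trans (Category.id_comp _))
  calc conjTheta Z L M e i j (twistBC ℂ ((N L M i).obj j) γ (σ' : ℂ ≃+* ℂ) hσ (gal L ((M i).obj j) γ') hρ)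
      = (Theta Z L M e i j).inv ≫ twistBC ℂ ((N L M i).obj j) γ (σ' : ℂ ≃+* ℂ) hσ (gal L ((M i).obj j) γ') hρ ≫
          (Theta Z L M e i j).hom := rfl
    _ = (((e i).inv.app j).left ≫ ((bcFunctorTowerIso (F i) L ℂ).inv.app ((M i).obj j)).left) ≫
          twistBC ℂ ((N L M i).obj j) γ (σ' : ℂ ≃+* ℂ) hσ (gal L ((M i).obj j) γ') hρ ≫
          ((bcFunctorTowerIso (F i) L ℂ).hom.app ((M i).obj j)).left ≫ ((e i).hom.app j).left := by
        rw [Theta_inv, Theta_hom]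
    _ = ((e i).inv.app j).left ≫ ((bcFunctorTowerIso (F i) L ℂ).inv.app ((M i).obj j)).left ≫
          twistBC ℂ ((N L M i).obj j) γ (σ' : ℂ ≃+* ℂ) hσ (gal L ((M i).obj j) γ') hρ ≫
          ((bcFunctorTowerIso (F i) L ℂ).hom.app ((M i).obj j)).left ≫ ((e i).hom.app j).left := Category.assoc _ _ _
    _ = ((e i).inv.app j).left ≫ ((bcFunctorTowerIso (F i) L ℂ).inv.app ((M i).obj j)).left ≫
          ((bcFunctorTowerIso (F i) L ℂ).hom.app ((M i).obj j)).left ≫ gal ℂ ((M i).obj j) σ' ≫ ((e i).hom.app j).left :=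
        whisker_eq _ (whisker_eq _ h1)
    _ = ((e i).inv.app j).left ≫ gal ℂ ((M i).obj j) σ' ≫ ((e i).hom.app j).left := whisker_eq _ h2

include hgal in
/-- **The identity is `Good`** for `γ = 1`: for `σ̃ ∈ Aut(ℂ/L)`, `𝟙 ⊠ σ̃ = gal σ̃` on `N j ⊗_L ℂ`, which through `Θ_{i₀}` is the
`e i₀`-conjugate of the Galois automorphism of `M i₀ j ⊗ ℂ` (tower), a twist by `hgal`. [cite: Deligne1971TravauxShimura, Lemme 5.10.1] -/
theorem good_one (j : J) : Good Z Tw L M e i₀ j (1 : L ≃ₐ[k] L) (Iso.refl _) := by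
  refine ⟨id_semilinear (k := k) ((N L M i₀).obj j), fun σ hσ => ?_⟩
  have hσL : ∀ x : L, σ (algebraMap L ℂ x) = algebraMap L ℂ x := fun x => by rw [hσ, AlgEquiv.one_apply]
  set σ' : ℂ ≃ₐ[F i₀] ℂ := algEquivOfFix σ (fix_of_fix_of_isScalarTower L i₀ σ hσL) with hσ'
  have key := conjTheta_twistBC_gal Z L M e i₀ j (1 : L ≃ₐ[F i₀] L) (1 : L ≃ₐ[k] L)
    (fun x => by rw [AlgEquiv.one_apply, AlgEquiv.one_apply]) σ' σ (coe_algEquivOfFix σ _).symm hσ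
    (by rw [gal_one]; exact id_semilinear (k := k) ((N L M i₀).obj j))
  have hgal1 : gal L ((M i₀).obj j) (1 : L ≃ₐ[F i₀] L) = 𝟙 _ := gal_one L ((M i₀).obj j)
  rw [twistBC_congr L ((N L M i₀).obj j) hσ _ hσ (id_semilinear (k := k) ((N L M i₀).obj j)) rfl rfl hgal1] at key
  change Tw j σ (conjTheta Z L M e i₀ j
    (twistBC ℂ ((N L M i₀).obj j) 1 σ hσ (𝟙 _) (id_semilinear (k := k) ((N L M i₀).obj j))))
  have hσσ : ((σ' : ℂ ≃ₐ[F i₀] ℂ) : ℂ ≃+* ℂ) = σ := coe_algEquivOfFix σ _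
  rw [key, ← hσσ]
  exact hgal i₀ j σ'

variable (hmul : ∀ (j : J) (σ ρ : ℂ ≃+* ℂ) (u v : (Z.obj j).left ⟶ (Z.obj j).left), Tw j σ u → Tw j ρ v → Tw j (σ * ρ) (v ≫ u))

include hext hmul in
/-- **Products of `Good` automorphisms are `Good`**: for `σ̃` extending `γ δ` write `σ̃ = σ̃₁ σ̃₂` with `σ̃₂` extending `δ` (exists, `hext`)
and `σ̃₁ := σ̃ σ̃₂⁻¹` extending `γ`; then `(ψ ≫ φ) ⊠ σ̃ = (ψ ⊠ σ̃₂) ≫ (φ ⊠ σ̃₁)` (✔ `twistBC_comp`) and `hmul`.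
[cite: Deligne1971TravauxShimura, Lemme 5.10.1 (p. 158)] -/
theorem good_mul (j : J) (γ δ : L ≃ₐ[k] L) (φ ψ : ((N L M i₀).obj j).left ≅ ((N L M i₀).obj j).left)
    (hφ : Good Z Tw L M e i₀ j γ φ) (hψ : Good Z Tw L M e i₀ j δ ψ) : Good Z Tw L M e i₀ j (γ * δ) (ψ ≪≫ φ) := by
  obtain ⟨hφs, hφt⟩ := hφ
  obtain ⟨hψs, hψt⟩ := hψ
  refine ⟨comp_semilinear ((N L M i₀).obj j) γ δ φ.hom ψ.hom hφs hψs, fun σ hσ => ?_⟩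
  obtain ⟨σ₂, hσ₂⟩ := hext δ
  let σ₁ : ℂ ≃+* ℂ := σ₂.symm.trans σ
  have hσ₁ : ∀ x : L, σ₁ (algebraMap L ℂ x) = algebraMap L ℂ (γ x) := fun x => by
    change σ (σ₂.symm (algebraMap L ℂ x)) = _
    rw [symm_extends L δ σ₂ hσ₂, hσ, AlgEquiv.mul_apply, AlgEquiv.aut_inv, AlgEquiv.apply_symm_apply]
  have e1 : σ₁ * σ₂ = σ := RingEquiv.ext fun x => by
    change σ (σ₂.symm (σ₂ x)) = σ x
    rw [RingEquiv.symm_apply_apply]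
  have e2 : σ₂.trans σ₁ = σ := RingEquiv.ext fun x => by
    change σ (σ₂.symm (σ₂ x)) = σ x
    rw [RingEquiv.symm_apply_apply]
  have hcomp := twistBC_comp ℂ ((N L M i₀).obj j) γ δ σ₁ σ₂ hσ₁ hσ₂ φ.hom ψ.hom hφs hψs
    (trans_extends ℂ γ δ σ₁ σ₂ hσ₁ hσ₂) (comp_semilinear ((N L M i₀).obj j) γ δ φ.hom ψ.hom hφs hψs)
  have key := hmul j σ₁ σ₂ _ _ (hφt σ₁ hσ₁) (hψt σ₂ hσ₂)
  rw [conjTheta_comp, hcomp, e1] at key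
  have htw : twistBC ℂ ((N L M i₀).obj j) (γ * δ) (σ₂.trans σ₁) (trans_extends ℂ γ δ σ₁ σ₂ hσ₁ hσ₂) (ψ.hom ≫ φ.hom)
      (comp_semilinear ((N L M i₀).obj j) γ δ φ.hom ψ.hom hφs hψs) =
      twistBC ℂ ((N L M i₀).obj j) (γ * δ) σ hσ (ψ ≪≫ φ).hom
        (comp_semilinear ((N L M i₀).obj j) γ δ φ.hom ψ.hom hφs hψs) :=
    twistBC_congr L ((N L M i₀).obj j) _ _ hσ _ rfl e2 rfl
  rw [htw] at key
  exact key

include hext hmul huniq hgal in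
/-- **Inverses of `Good` automorphisms are `Good`** (finite Galois group: `γ` has finite order `n`, the iterates `φ^[m]` are `Good` for
`γ^m` by `good_mul`, `φ^[n]` is `Good` for `1` hence the identity by `good_unique`/`good_one`, so `φ^[n-1] = φ⁻¹` is `Good` for
`γ^{n-1} = γ⁻¹`). [cite: Deligne1971TravauxShimura, Lemme 5.10.1 (p. 158)] -/
theorem good_inv [FiniteDimensional k L] (j : J) (γ : L ≃ₐ[k] L) (φ : ((N L M i₀).obj j).left ≅ ((N L M i₀).obj j).left)
    (hφ : Good Z Tw L M e i₀ j γ φ) : Good Z Tw L M e i₀ j γ⁻¹ φ.symm := by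
  -- iterates
  let pw : ℕ → (((N L M i₀).obj j).left ≅ ((N L M i₀).obj j).left) := fun m => Nat.rec (Iso.refl _) (fun _ X => φ ≪≫ X) m
  have pw_zero : pw 0 = Iso.refl _ := rfl
  have pw_succ : ∀ m, pw (m + 1) = φ ≪≫ pw m := fun m => rfl
  have hpw : ∀ m, Good Z Tw L M e i₀ j (γ ^ m) (pw m) := by
    intro m
    induction m with
    | zero => rw [pow_zero, pw_zero]; exact good_one Z Tw L M e i₀ hgal j
    | succ m ih => rw [pow_succ, pw_succ]; exact good_mul Z Tw L M e i₀ hext hmul j _ _ _ _ ih hφ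
  -- finite order
  obtain ⟨n, hn, hγn⟩ := (isOfFinOrder_of_finite γ).exists_pow_eq_one
  have hn1 : pw n = Iso.refl _ :=
    good_unique Z Tw L M e i₀ hext huniq j (1 : L ≃ₐ[k] L) _ _ (hγn ▸ hpw n) (good_one Z Tw L M e i₀ hgal j)
  obtain ⟨m, rfl⟩ : ∃ m, n = m + 1 := Nat.exists_eq_add_one_of_ne_zero hn.ne'
  have hinv : γ⁻¹ = γ ^ m := inv_eq_of_mul_eq_one_right (by rwa [pow_succ'] at hγn)
  have hsymm : φ.symm = pw m := by
    have h := hn1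
    rw [pw_succ] at h
    -- `φ ≪≫ pw m = refl` ⇒ `pw m = φ.symm`
    have := congrArg (fun X => φ.symm ≪≫ X) h
    simpa only [Iso.symm_self_id_assoc, Iso.trans_refl] using this.symm
  rw [hinv, hsymm]
  exact hpw m

/-! ### §5. The complex Galois action of each model, read through `Θ`; the `L`-isomorphisms `ψ i : N i₀ ≅ N i` (Prop. 13.1) -/

/-- An automorphism of `ℂ` over `L`, re-based over `F i ⊆ L`. [cite: GortzWedhorn2020, §(14.20)] -/
def rebase (i : ι) (θ : ℂ ≃ₐ[L] ℂ) : ℂ ≃ₐ[F i] ℂ :=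
  algEquivOfFix (θ : ℂ ≃+* ℂ) (fix_of_fix_of_isScalarTower L i (θ : ℂ ≃+* ℂ) θ.commutes)

/-- `rebase` does not change the underlying ring automorphism. [cite: GortzWedhorn2020, §(14.20)] -/
theorem coe_rebase (i : ι) (θ : ℂ ≃ₐ[L] ℂ) : ((rebase L i θ : ℂ ≃ₐ[F i] ℂ) : ℂ ≃+* ℂ) = (θ : ℂ ≃+* ℂ) :=
  coe_algEquivOfFix _ _

/-- **The Galois automorphism `gal θ` of `N i j ⊗_L ℂ` (`θ ∈ Aut(ℂ/L)`), read on `Z j` through `Θ_i`, is the `e i`-conjugate of the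
Galois automorphism `gal θ` of `M i j ⊗_{F i} ℂ`** (tower). [cite: GortzWedhorn2020, Prop. 4.16 and §(14.20)] -/
theorem conjTheta_gal (i : ι) (j : J) (θ : ℂ ≃ₐ[L] ℂ) :
    conjTheta Z L M e i j (gal ℂ ((N L M i).obj j) θ) =
      ((e i).inv.app j).left ≫ gal ℂ ((M i).obj j) (rebase L i θ) ≫ ((e i).hom.app j).left := by
  have hθ : ∀ x : L, (θ : ℂ ≃+* ℂ) (algebraMap L ℂ x) = algebraMap L ℂ ((1 : L ≃ₐ[F i] L) x) := fun x => by
    rw [AlgEquiv.one_apply]; exact θ.commutes x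
  have h1 : gal ℂ ((N L M i).obj j) θ = twistBC ℂ ((N L M i).obj j) (1 : L ≃ₐ[F i] L) (θ : ℂ ≃+* ℂ) hθ (𝟙 _)
      (id_semilinear (k := F i) ((N L M i).obj j)) := (twistBC_id_eq_gal ℂ ((N L M i).obj j) θ hθ _).symm
  have hgal1 : gal L ((M i).obj j) (1 : L ≃ₐ[F i] L) = 𝟙 _ := gal_one L ((M i).obj j)
  have key := conjTheta_twistBC_gal Z L M e i j (1 : L ≃ₐ[F i] L) (1 : L ≃ₐ[F i] L)
    (fun x => rfl) (rebase L i θ) (θ : ℂ ≃+* ℂ) (coe_rebase (F := F) L i θ).symm hθ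
    (by rw [gal_one]; exact id_semilinear (k := F i) ((N L M i).obj j))
  rw [twistBC_congr L ((N L M i).obj j) hθ _ hθ (id_semilinear (k := F i) ((N L M i).obj j)) rfl rfl hgal1] at key
  rw [h1]
  exact key

include hgal in
/-- For `θ ∈ Aut(ℂ/L)` the conjugate `Θ_i⁻¹ ∘ gal θ ∘ Θ_i` is a twist for `θ`. [cite: Milne2005ShimuraVarieties, Def. 12.8 (62)] -/
theorem tw_conjTheta_gal (i : ι) (j : J) (θ : ℂ ≃ₐ[L] ℂ) :
    Tw j (θ : ℂ ≃+* ℂ) (conjTheta Z L M e i j (gal ℂ ((N L M i).obj j) θ)) := by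
  rw [conjTheta_gal, ← coe_rebase (F := F) L i θ]
  exact hgal i j (rebase L i θ)

/-- **The complex identification `Θ_{i₀} ≫ Θ_i⁻¹ : N i₀ j ⊗ ℂ ≅ N i j ⊗ ℂ` of the two models over `L`**, as an isomorphism in
`SchemeOver ℂ`. [cite: Deligne1971TravauxShimura, Cor. 5.5 and Prop. 5.10 proof (p. 157)] -/
def complexIso (i : ι) (j : J) : (bcFunctor L ℂ).obj ((N L M i₀).obj j) ≅ (bcFunctor L ℂ).obj ((N L M i).obj j) :=
  (ThetaIso Z L M e i₀).app j ≪≫ ((ThetaIso Z L M e i).app j).symm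

/-- Its underlying morphism: `Θ_{i₀}.hom ≫ Θ_i.inv` (by `rfl`). [cite: Deligne1971TravauxShimura, Prop. 5.10 proof] -/
theorem complexIso_hom_left (i : ι) (j : J) :
    (complexIso Z L M e i₀ i j).hom.left = (Theta Z L M e i₀ j).hom ≫ (Theta Z L M e i j).inv := rfl

/-- And its inverse: `Θ_i.hom ≫ Θ_{i₀}.inv` (by `rfl`). [cite: Deligne1971TravauxShimura, Prop. 5.10 proof] -/
theorem complexIso_inv_left (i : ι) (j : J) :
    (complexIso Z L M e i₀ i j).inv.left = (Theta Z L M e i j).hom ≫ (Theta Z L M e i₀ j).inv := rfl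

include huniq hgal in
/-- **The complex identification is `Aut(ℂ/L)`-equivariant**: both Galois actions are, read on `Z j`, THE twist (`huniq`).
[cite: Milne2005ShimuraVarieties, Thm. 13.6 p. 118 (σ(f) = f)] [cite: Deligne1971TravauxShimura, Cor. 5.5] -/
theorem gal_comp_complexIso (i : ι) (j : J) (θ : ℂ ≃ₐ[L] ℂ) :
    gal ℂ ((N L M i₀).obj j) θ ≫ (complexIso Z L M e i₀ i j).hom.left =
      (complexIso Z L M e i₀ i j).hom.left ≫ gal ℂ ((N L M i).obj j) θ := by
  have h := huniq j (θ : ℂ ≃+* ℂ) _ _ (tw_conjTheta_gal Z Tw L M e hgal i₀ j θ) (tw_conjTheta_gal Z Tw L M e hgal i j θ)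
  -- `Θ₀⁻¹ g₀ Θ₀ = Θᵢ⁻¹ gᵢ Θᵢ` ⇒ `g₀ (Θ₀ Θᵢ⁻¹) = (Θ₀ Θᵢ⁻¹) gᵢ`
  have h' := congrArg (fun u => (Theta Z L M e i₀ j).hom ≫ u ≫ (Theta Z L M e i j).inv) h
  simp only [conjTheta, Category.assoc, Iso.hom_inv_id_assoc, Iso.hom_inv_id, Category.comp_id] at h'
  rw [complexIso_hom_left, Category.assoc]
  exact h'

include huniq hgal in
/-- **The models become isomorphic over `L`**: an `L`-isomorphism `ψ : N i₀ j ≅ N i j` whose complex base change is `Θ_{i₀} ≫ Θ_i⁻¹`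
([Milne2005ShimuraVarieties] Prop. 13.1 ∕ Cor. 13.2 = [Deligne1971TravauxShimura] Cor. 5.5 over `L`; hypotheses: `L` countable, the complex
fibres reduced, the models separated over `L`). [cite: Deligne1971TravauxShimura, Cor. 5.5 (p. 156)]
[cite: Milne2005ShimuraVarieties, Prop. 13.1 and Cor. 13.2 p. 117] -/
theorem exists_psi (hL : #L ≤ ℵ₀) (i : ι) (j : J) (hr₀ : IsReduced (bc ℂ ((N L M i₀).obj j)))
    (hrᵢ : IsReduced (bc ℂ ((N L M i).obj j))) (hs₀ : IsSeparated ((N L M i₀).obj j).hom)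
    (hsᵢ : IsSeparated ((N L M i).obj j).hom) :
    ∃ ψ : (N L M i₀).obj j ≅ (N L M i).obj j, (bcFunctor L ℂ).map ψ.hom = (complexIso Z L M e i₀ i j).hom :=
  GaloisDescent.exists_iso_map_eq_of_forall_gal_comp_of_isReduced hL _ _ (complexIso Z L M e i₀ i j)
    (gal_comp_complexIso Z Tw L M e i₀ huniq hgal i j)

/-! ### §6. Existence of `Good` automorphisms on the generating subgroups `Gal(L / F i)` -/

/-- `γ ∈ Aut(L/k)` fixing `F i` pointwise, re-based over `F i`. [cite: GortzWedhorn2020, §(14.20)] -/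
def rebaseGal (i : ι) (γ : L ≃ₐ[k] L) (hγ : ∀ x : F i, γ (algebraMap (F i) L x) = algebraMap (F i) L x) : L ≃ₐ[F i] L :=
  AlgEquiv.ofRingEquiv (f := (γ : L ≃+* L)) hγ

omit [Algebra L ℂ] [∀ i, Algebra (F i) ℂ] [∀ i, IsScalarTower (F i) L ℂ] in
/-- `rebaseGal` has the same values. [cite: GortzWedhorn2020, §(14.20)] -/
theorem rebaseGal_apply (i : ι) (γ : L ≃ₐ[k] L) (hγ : ∀ x : F i, γ (algebraMap (F i) L x) = algebraMap (F i) L x) (x : L) :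
    γ x = rebaseGal L i γ hγ x := rfl

/-- The Galois automorphism of `N i j = M i j ⊗ L` as an automorphism of its underlying scheme. [cite: GortzWedhorn2020, §(14.20)] -/
def galIsoL (i : ι) (j : J) (γ' : L ≃ₐ[F i] L) : ((N L M i).obj j).left ≅ ((N L M i).obj j).left where
  hom := gal L ((M i).obj j) γ'
  inv := gal L ((M i).obj j) γ'⁻¹
  hom_inv_id := gal_comp_gal_symm L ((M i).obj j) γ'
  inv_hom_id := gal_symm_comp_gal L ((M i).obj j) γ'

/-- **The candidate**: the Galois automorphism of `N i j` transported to `N i₀ j` along `ψ`. [cite: Deligne1971TravauxShimura, Prop. 5.10 proof (p. 157)] -/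
def transported (i : ι) (j : J) (γ' : L ≃ₐ[F i] L) (ψ : (N L M i₀).obj j ≅ (N L M i).obj j) :
    ((N L M i₀).obj j).left ≅ ((N L M i₀).obj j).left :=
  (Over.forget _).mapIso ψ ≪≫ galIsoL L M i j γ' ≪≫ ((Over.forget _).mapIso ψ).symm

omit [Algebra L ℂ] [∀ i, Algebra (F i) ℂ] [∀ i, IsScalarTower (F i) L ℂ] in
/-- Its underlying morphism. [cite: Deligne1971TravauxShimura, Prop. 5.10 proof] -/
theorem transported_hom (i : ι) (j : J) (γ' : L ≃ₐ[F i] L) (ψ : (N L M i₀).obj j ≅ (N L M i).obj j) :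
    (transported L M i₀ i j γ' ψ).hom = ψ.hom.left ≫ gal L ((M i).obj j) γ' ≫ ψ.inv.left := rfl

omit [Algebra L ℂ] [∀ i, Algebra (F i) ℂ] [∀ i, IsScalarTower (F i) L ℂ] in
/-- The transported automorphism is `γ`-semilinear. [cite: GortzWedhorn2020, §(14.20)] -/
theorem transported_semilinear (i : ι) (j : J) (γ' : L ≃ₐ[F i] L) (γ : L ≃ₐ[k] L) (hγ : ∀ x, γ x = γ' x)
    (ψ : (N L M i₀).obj j ≅ (N L M i).obj j) :
    (transported L M i₀ i j γ' ψ).hom ≫ ((N L M i₀).obj j).hom = ((N L M i₀).obj j).hom ≫ specAut L γ⁻¹ := by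
  have hg : gal L ((M i).obj j) γ' ≫ ((N L M i).obj j).hom = ((N L M i).obj j).hom ≫ specAut L γ⁻¹ :=
    gal_semilinear (F i) ((M i).obj j) γ' γ hγ
  rw [transported_hom, Category.assoc, Category.assoc, Over.w ψ.inv, hg, ← Category.assoc, Over.w ψ.hom]

include hgal in
/-- **The transported automorphism is `Good`**: `(ψ galᵢ ψ⁻¹) ⊠ σ̃ = (ψ ⊗ ℂ)(galᵢ ⊠ σ̃)(ψ ⊗ ℂ)⁻¹` (✔ `twistBC_naturality`), `ψ ⊗ ℂ = Θ_{i₀} Θ_i⁻¹`,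
so through `Θ_{i₀}` it reads as `galᵢ ⊠ σ̃` through `Θ_i`, i.e. the `e i`-conjugate of `gal σ̃` of `M i j ⊗ ℂ` (tower) — a twist (`hgal`).
[cite: Deligne1971TravauxShimura, Prop. 5.10 proof and Lemme 5.10.1 (pp. 157–158)] -/
theorem good_transported (i : ι) (j : J) (γ : L ≃ₐ[k] L) (hγ : ∀ x : F i, γ (algebraMap (F i) L x) = algebraMap (F i) L x)
    (ψ : (N L M i₀).obj j ≅ (N L M i).obj j) (hψ : (bcFunctor L ℂ).map ψ.hom = (complexIso Z L M e i₀ i j).hom) :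
    Good Z Tw L M e i₀ j γ (transported L M i₀ i j (rebaseGal L i γ hγ) ψ) := by
  refine ⟨transported_semilinear L M i₀ i j _ γ (rebaseGal_apply L i γ hγ) ψ, fun σ hσ => ?_⟩
  set γ' := rebaseGal L i γ hγ with hγ'
  set σ' : ℂ ≃ₐ[F i] ℂ := algEquivOfFix σ (fix_of_extends L i γ' σ (fun x => (hσ x).trans rfl)) with hσ'def
  have hσσ : ((σ' : ℂ ≃ₐ[F i] ℂ) : ℂ ≃+* ℂ) = σ := coe_algEquivOfFix σ _
  -- naturality of `⊠` along `ψ`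
  have hcomm : (transported L M i₀ i j γ' ψ).hom ≫ ψ.hom.left = ψ.hom.left ≫ gal L ((M i).obj j) γ' := by
    have h1 : ψ.inv.left ≫ ψ.hom.left = 𝟙 _ := by rw [← Over.comp_left, ψ.inv_hom_id]; rfl
    rw [transported_hom, Category.assoc, Category.assoc, h1]
    erw [Category.comp_id]
  have hnat := twistBC_naturality ℂ γ σ hσ (transported L M i₀ i j γ' ψ).hom
    (transported_semilinear L M i₀ i j γ' γ (rebaseGal_apply L i γ hγ) ψ) (gal L ((M i).obj j) γ')
    (gal_semilinear (F i) ((M i).obj j) γ' γ (rebaseGal_apply L i γ hγ)) ψ.hom hcomm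
  have hleft : ((bcFunctor L ℂ).map ψ.hom).left = (Theta Z L M e i₀ j).hom ≫ (Theta Z L M e i j).inv :=
    congrArg CommaMorphism.left hψ
  rw [hleft] at hnat
  -- unconjugate: `Θ₀⁻¹ (φ ⊠ σ) Θ₀ = Θᵢ⁻¹ (galᵢ ⊠ σ) Θᵢ`
  have hnat' := congrArg (fun u => (Theta Z L M e i₀ j).inv ≫ u ≫ (Theta Z L M e i j).hom) hnat
  simp only [Category.assoc, Iso.inv_hom_id, Category.comp_id, Iso.inv_hom_id_assoc] at hnat'
  change Tw j σ ((Theta Z L M e i₀ j).inv ≫ twistBC ℂ ((N L M i₀).obj j) γ σ hσ (transported L M i₀ i j γ' ψ).hom _ ≫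
    (Theta Z L M e i₀ j).hom)
  rw [hnat']
  have key := conjTheta_twistBC_gal Z L M e i j γ' γ (rebaseGal_apply L i γ hγ) σ' σ hσσ.symm hσ
    (gal_semilinear (F i) ((M i).obj j) γ' γ (rebaseGal_apply L i γ hγ))
  change Tw j σ (conjTheta Z L M e i j (twistBC ℂ ((N L M i).obj j) γ σ hσ (gal L ((M i).obj j) γ') _))
  rw [key, ← hσσ]
  exact hgal i j σ'

include huniq hgal in
/-- **Existence on the generating subgroups**: every `γ ∈ Aut(L/k)` fixing `F i` pointwise has a `Good` automorphism of `N i₀ j`.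
[cite: Deligne1971TravauxShimura, Prop. 5.10 proof and Lemme 5.10.1 (pp. 157–158)] -/
theorem good_of_mem (hL : #L ≤ ℵ₀) (i : ι) (j : J) (hr₀ : IsReduced (bc ℂ ((N L M i₀).obj j)))
    (hrᵢ : IsReduced (bc ℂ ((N L M i).obj j))) (hs₀ : IsSeparated ((N L M i₀).obj j).hom)
    (hsᵢ : IsSeparated ((N L M i).obj j).hom)
    (γ : L ≃ₐ[k] L) (hγ : ∀ x : F i, γ (algebraMap (F i) L x) = algebraMap (F i) L x) :
    ∃ φ, Good Z Tw L M e i₀ j γ φ := by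
  obtain ⟨ψ, hψ⟩ := exists_psi Z Tw L M e i₀ huniq hgal hL i j hr₀ hrᵢ hs₀ hsᵢ
  exact ⟨_, good_transported Z Tw L M e i₀ hgal i j γ hγ ψ hψ⟩

/-! ### §7. Naturality in the level (D2) -/

variable (hnat : ∀ ⦃j j' : J⦄ (f : j ⟶ j') (σ : ℂ ≃+* ℂ) (u : (Z.obj j).left ⟶ (Z.obj j).left)
    (u' : (Z.obj j').left ⟶ (Z.obj j').left), Tw j σ u → Tw j' σ u' → u ≫ (Z.map f).left = (Z.map f).left ≫ u')

include hext hnat in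
/-- **`Good` automorphisms commute with the transition maps** (`hnat` read back through `Θ`, then ✔ `comp_eq_comp_of_twistBC`).
[cite: Deligne1971TravauxShimura, Prop. 5.10 proof (compatibility with the levels)] -/
theorem good_natural {j j' : J} (f : j ⟶ j') (γ : L ≃ₐ[k] L) (φ : ((N L M i₀).obj j).left ≅ ((N L M i₀).obj j).left)
    (φ' : ((N L M i₀).obj j').left ≅ ((N L M i₀).obj j').left) (hφ : Good Z Tw L M e i₀ j γ φ)
    (hφ' : Good Z Tw L M e i₀ j' γ φ') :
    φ.hom ≫ ((N L M i₀).map f).left = ((N L M i₀).map f).left ≫ φ'.hom := by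
  obtain ⟨σ, hσ⟩ := hext γ
  obtain ⟨hφs, hφt⟩ := hφ
  obtain ⟨hφ's, hφ't⟩ := hφ'
  have h := hnat f σ _ _ (hφt σ hσ) (hφ't σ hσ)
  -- `Θ` is natural: `(bc (N f)).left ≫ Θ_{j'} = Θ_j ≫ Z f`
  have hΘ := Theta_natural Z L M e i₀ f
  have h' := congrArg (fun u => (Theta Z L M e i₀ j).hom ≫ u ≫ (Theta Z L M e i₀ j').inv) h
  simp only [conjTheta, Category.assoc, Iso.hom_inv_id_assoc, Iso.hom_inv_id, Category.comp_id] at h'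
  have hBC : ((bcFunctor L ℂ).map ((N L M i₀).map f)).left =
      (Theta Z L M e i₀ j).hom ≫ (Z.map f).left ≫ (Theta Z L M e i₀ j').inv :=
    ((Iso.eq_comp_inv _).mpr hΘ).trans (Category.assoc _ _ _)
  rw [← reassoc_of% hBC, ← hBC] at h'
  exact comp_eq_comp_of_twistBC ℂ γ σ hσ φ.hom hφs φ'.hom hφ's ((N L M i₀).map f) h'

end Setting

end GaloisDescentTwist

end Literature.AlgebraicGeometry.Motives

end
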